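import Summits.FinalStateConjecture.FinalStateConjecture.Theses.SwallowTheDatum
import Summits.FinalStateConjecture.FinalStateConjecture.Theorems.KerrShieldedDataExist.Negative.SliceClause
import Summits.FinalStateConjecture.FinalStateConjecture.Theorems.SwallowTheDatumKerrShieldedDataExistAssemblyGlue
import Summits.FinalStateConjecture.FinalStateConjecture.Theorems.SwallowTheDatumKerrShieldedDataExistStubIsotropicEnd
import Summits.FinalStateConjecture.FinalStateConjecture.Theorems.SwallowTheDatumKerrShieldedDataExistStubCapProfile
import Summits.FinalStateConjecture.FinalStateConjecture.Theorems.SwallowTheDatumKerrShieldedDataExistStubCapImmersion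
import Summits.FinalStateConjecture.FinalStateConjecture.Theorems.SwallowTheDatumKerrShieldedDataExistStubCapGlue
import Summits.FinalStateConjecture.FinalStateConjecture.Theorems.SwallowTheDatumKerrShieldedDataExistStubCapShield
import Summits.FinalStateConjecture.FinalStateConjecture.Theorems.SwallowTheDatumKerrShieldedDataExistStubCapFarH
import Summits.FinalStateConjecture.FinalStateConjecture.Theorems.SwallowTheDatumKerrShieldedDataExistStubCapFarK
import Literature.Geometry.Lorentzian.InteriorKerrGluing
import Literature.Geometry.Lorentzian.KerrRicciFlat
import Literature.Geometry.Lorentzian.InducedVacuumData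
import Literature.Geometry.Lorentzian.AsymptoticallyFlatCompleteness
import Literature.Geometry.Lorentzian.DecaySymbols
import Literature.Geometry.Lorentzian.FinalState
import HarnessLib

/-!
# Line `plug-the-second-sheet` for crux `KerrShieldedDataExist` (stmt-FinalStateConjecture-10055) —
# skeleton v4 (lead c1, 2026-08-16): RESHAPED to the Li–Mei pocket + printed interior Kerr gluing +
# explicit Kerr capping ("KerrCap")

History. v1–v3 (planner; lead -0): time-symmetric bag of gold through the Einstein–Rosen throat at `a = 0`;
six of seven stubs LANDED (p75525 p76410 p78899 p85729 p91908 p94578) and the reduction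
`kerrShieldedDataExist_of_plugData` (p94934); the seventh, `stub_plugData`, is NOT IN PRINT (new combination of
a cap engine with Chruściel–Delay projected gluing on a strong-field Schwarzschild annulus) and was handed back.

v4 keeps the composition idea of the line — an EXACT black-hole interior re-sliced by closed formulas onto the
crux's pinned leaf, plus a capped pocket — and changes the pocket engine to the one the crux docstring names:
Li–Mei, *A construction of collapsing spacetimes in vacuum*, CMP 378 (2020) = arXiv:2005.01249.

* `stub_exactPocket` (NAMED FACTS + plumbing, lead): there is a smooth datum `D'` on `E3`, VACUUM on a ball
  `{‖y‖ < ρ₂}` and EXACTLY the Kerr(`M, a`)-cylinder datum `{r = r₀}`, `r₋ < r₀ < r₊`, in standard position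
  (`LiMei.IsKerrCylinderOn M a r₀ τ₀ id`) on a collar `{σ₂ < ‖y‖ < ρ₂}`. Source: the near-Schwarzschild pocket of
  Li–Mei Thm 2.1 + §2.2 (short-pulse interior + the cylinder piece `H = {r = r₀ < 2m₀}`; ONE new Literature
  named fact `LiMei.nearSchwarzschildPocket`) fed into the PRINTED interior Kerr gluing Prop 4.1 = Thm 2.2,
  already vendored as `LiMei.interiorKerrGluing` (`Literature/…/InteriorKerrGluing.lean`, general spin —
  whence `a ≠ 0` is allowed below), then rotated into standard position (`comap` by the linear isometry).
* `stub_capProfile` (real analysis): profile functions `(τ, ϱ, α)` of one radial variable `s = ‖u‖` with a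
  cylinder zone (`τ = s + τ₀`, `ϱ = r₀`, `α = −arctan(a/r₀)`), a corner in the black-hole region
  (`τ′, ϱ′ ≥ 0`, `ϱ ≤ r_b < r₊`), the pinned graph zone (`τ = T_{M,a}(ϱ) + c`, `ϱ′ > 0`, smooth inverse `ϱ⁻¹`)
  and the quasi-isotropic Boyer–Lindquist far zone (`ϱ(s) = s + M + (M² − a²)/4s`, `α = χ(ϱ)`,
  `χ(r) = (a/(r₊ − r₋)) log((r − r₊)/(r − r₋))`, `χ′ = a/Δ`).
* `stub_capImmersion` (Kerr–Schild chart calculus): the CAP MAP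
  `Ψ(u) = (τ(s), L_{ϱ(s)} Rot_z(α(s)) (u/s))`, `L_r n = r n + a ẑ × n` (= Kerr's spheroidal point `Y_a(r, n)`,
  radius `r`), is a smooth spacelike immersion of `{‖u‖ > σ}` into `(Kerr.region a r_c, g_{M,a})` with a smooth
  future unit normal: its conormal `ϱ′ dt* − τ′ dr` has `g⁻¹`-square `−(1+2H)ϱ′² − 4Hϱ′τ′ + (Δ/Σ)τ′² < 0`
  (corner: `Δ < 0`; graph zone: the landed certificate `Negative.conormalForm_bentSlope_neg`).
* `stub_capGlue` (gluing): `D'` on the ball and the induced vacuum data of `Ψ` (`InducedVacuumData.lean` +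
  `Kerr.ricci_smoothMetric`, all spins) agree on the collar (`Ψ =` the standard Kerr cylinder map there) and glue
  to ONE vacuum datum `C` on `E3` (`Assembly.exists_initialDataSet_of_localData`).
* `stub_capShield` (lead): `C` satisfies the crux's shielding block with `(M, a)`, `r₁ = r_b`, the literal height,
  `ψ = Negative.graph M a r_b`, `ν = Negative.graphNormal M a r_b` and the end chart
  `φ(x⃗) = ϱ⁻¹(r) · Rot_z(−α(ϱ⁻¹ r)) ℓ⃗(x⃗)` (inverse of the cap map on the graph zone; time-translation and
  reparametrisation invariance of the induced data).
* `stub_capFarH`, `stub_capFarK` (asymptotics): on the far zone the induced metric is the Boyer–Lindquist slice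
  metric in quasi-isotropic Cartesian coordinates, `h = (Σ/s²) δ + a²(r²+2Mr+a²μ²)/(Σ s⁴) (u×v)₃ (u×w)₃`,
  `Σ/s² = 1 + 2M/s + O(s⁻²)`, and `k = O(aM s⁻³)`: `h − (1 + 2M/s)δ ∈ O₂(s⁻²)`, `k ∈ O₁(s⁻³)` as smooth symbols
  (`DecaySymbols*.lean`), which is Dafermos–Rodnianski admissibility with template mass `M` on the tautological end.

STATUS (lead c1, end of cycle 1, 2026-08-16): ALL SIX GEOMETRIC STUBS ARE THEOREMS OF THE TREE — `stub_capProfile`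
(p104626), `stub_capImmersion` (p110545), `stub_capGlue` (p111680), `stub_capShield` (p113507), `stub_capFarH` (p120749),
`stub_capFarK` (p123395), each re-exported below by name from `Theorems/SwallowTheDatumKerrShieldedDataExistStubCap*.lean`.
The ONLY `sorry` left is `stub_exactPocket`, the named-fact end of the line: it is CLOSED MODULO the two published Li–Mei
theorems by `Theorems.SwallowTheDatum.exactPocket_of_liMei : LiMei.nearSchwarzschildPocket → LiMei.interiorKerrGluing → …`
(`Theorems/SwallowTheDatumKerrShieldedDataExistExactPocketOfLiMei.lean`, p123706); the durable reductions are
`kerrShieldedDataExist_of_exactPocket` / `kerrShieldedDataExist_of_liMei` (`Theorems/…OfExactPocket.lean`, `…OfLiMei.lean`).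
Composition `KerrShieldedDataExist_of` has no `sorry` of its own; the one `sorry` lives in `stub_exactPocket`.
References: Li–Mei arXiv:2005.01249 Thm 2.1, §2.2, Prop 4.1; Visser arXiv:0706.0622 (32)–(36); O'Neill 1983 Ch. 4;
Brandt–Seidel, PRD 54 (1996) 1403 (quasi-isotropic radius `r = s + M + (M² − a²)/4s`); Dafermos–Rodnianski
arXiv:0811.0354 App. B.2.3; Bartnik–Isenberg 2004 §2.
-/

set_option linter.dupNamespace false

noncomputable section

open Set Function Filter Topology TopologicalSpace
open scoped Manifold ContDiff Topology InnerProductSpace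
open Literature.Geometry.Lorentzian
open Summit.FinalStateConjecture.FinalStateConjecture.Theorems.KerrShieldedDataExist
open Summit.FinalStateConjecture.FinalStateConjecture.Theorems.SwallowTheDatum

namespace Summit.FinalStateConjecture.FinalStateConjecture.Cruxes.KerrShieldedDataExist.PlugTheSecondSheet

/-! ## Stub 0 — the exact Kerr-cylinder pocket (named facts: Li–Mei Thm 2.1+§2.2, Prop 4.1) -/

/-- **Stub `stub_exactPocket`** (NAMED FACTS + plumbing): a smooth datum on `E3`, vacuum on the ball `{‖y‖ < ρ₂}`,
which on the collar `{σ₂ < ‖y‖ < ρ₂}` is EXACTLY the Kerr(`M, a`)-cylinder datum `{r = r₀}`, `r₋ < r₀ < r₊`, in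
standard position (`kerrCylMap r₀ a τ₀ id`). From the Li–Mei near-Schwarzschild pocket (Thm 2.1 + §2.2) and the
printed interior Kerr gluing `LiMei.interiorKerrGluing` (Prop 4.1), rotated into standard position. NOT provable
inside the tree (named-fact end of the line); CLOSED MODULO THE TWO FACTS by the landed conditional
`Theorems.SwallowTheDatum.exactPocket_of_liMei` (the `sorry` below is exactly `exactPocket_of_liMei ?fact₁ ?fact₂`).
[cite: LiMei2020, Thm 2.1, §2.2, Prop 4.1] -/
theorem stub_exactPocket : ∀ [Kerr.Facts],
    ∃ (M a r₀ τ₀ σ₂ ρ₂ : ℝ) (D' : InitialDataSet (𝓡 3) E3),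
      |a| < M ∧ Kerr.rMinus M a < r₀ ∧ r₀ < Kerr.rPlus M a ∧ 1 ≤ σ₂ ∧ σ₂ < ρ₂ ∧
      LiMei.IsVacuumOn {y : E3 | ‖y‖ < ρ₂} D' ∧
      LiMei.IsKerrCylinderOn M a r₀ τ₀ LinearIsometry.id {y : E3 | σ₂ < ‖y‖ ∧ ‖y‖ < ρ₂} D' := by
  sorry

/-! ## Stub 1 — the cap profile -/

/-- **Stub `stub_capProfile`** (one-variable real analysis): the profile functions of the cap. Cylinder zone
`s ≤ σ₃`; corner `[σ₃, σ₄]` inside the black hole (`ϱ ≤ r_b < r₊`, both slopes `≥ 0`, never both `0`); graph zone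
`s ≥ σ₄` (`τ = T_{M,a}(ϱ) + c`, `ϱ′ > 0`, smooth inverse `ϱinv` on `(r_b, ∞)`); far zone `s ≥ σ₅`
(quasi-isotropic radius and Boyer–Lindquist untwisting angle). Built from `Real.smoothTransition` interpolations.
[cite: BrandtSeidel1996, (quasi-isotropic radius)] -/
theorem stub_capProfile :
    ∀ (M a r₀ τ₀ σ₃ : ℝ), |a| < M → Kerr.rMinus M a < r₀ → r₀ < Kerr.rPlus M a → 1 ≤ σ₃ →
      ∃ (τ ϱ α ϱinv : ℝ → ℝ) (σ₄ σ₅ c rb : ℝ),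
        σ₃ < σ₄ ∧ σ₄ < σ₅ ∧ r₀ < rb ∧ rb < Kerr.rPlus M a ∧
        ContDiff ℝ ∞ τ ∧ ContDiff ℝ ∞ ϱ ∧ ContDiff ℝ ∞ α ∧
        (∀ s, s ≤ σ₃ → τ s = s + τ₀ ∧ ϱ s = r₀ ∧ α s = -Real.arctan (a / r₀)) ∧
        (∀ s, r₀ ≤ ϱ s) ∧ (∀ s, 0 ≤ deriv τ s) ∧ (∀ s, 0 ≤ deriv ϱ s) ∧
        (∀ s, 0 < deriv τ s + deriv ϱ s) ∧
        (∀ s, s ≤ σ₄ → ϱ s ≤ rb) ∧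
        (∀ s, σ₄ ≤ s → τ s = Negative.bentHeight M a (ϱ s) + c ∧ 0 < deriv ϱ s) ∧
        (∀ s, σ₄ < s → rb < ϱ s ∧ ϱinv (ϱ s) = s) ∧
        (∀ r, rb < r → σ₄ < ϱinv r ∧ ϱ (ϱinv r) = r) ∧
        ContDiffOn ℝ ∞ ϱinv (Set.Ioi rb) ∧
        (∀ s, σ₅ ≤ s → ϱ s = s + M + (M ^ 2 - a ^ 2) / (4 * s) ∧
          α s = a / (Kerr.rPlus M a - Kerr.rMinus M a) *
            Real.log ((ϱ s - Kerr.rPlus M a) / (ϱ s - Kerr.rMinus M a))) ∧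
        (∀ s, σ₅ ≤ s → 8 * M < ϱ s) :=
  @Summit.FinalStateConjecture.FinalStateConjecture.Theorems.SwallowTheDatum.stub_capProfile


/-! ## Stub 2 — the cap map is a spacelike immersion with a smooth future unit normal -/

/-- **Stub `stub_capImmersion`** (Kerr–Schild chart calculus, all spins): for profiles as in `stub_capProfile`
the cap map `Ψ(u) = (τ(s), X(u))`, `X(u) = L_{ϱ(s)} Rot_z(α(s)) (u/s)`, `s = ‖u‖`, has Kerr–Schild radius
`r(X u) = ϱ(s)`, and is a smooth spacelike immersion of `{‖u‖ > σ}` into `(Kerr.region a r_c, g_{M,a})`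
(`0 ≤ r_c < r₀`) carrying a `C^∞` future unit normal: the conormal `ϱ′dt* − τ′dr` annihilates `dΨ` and has
`g⁻¹`-square `−(1+2H)ϱ′² − 4Hϱ′τ′ + (Δ/Σ)τ′² < 0` (corner: `Δ(ϱ) < 0` on `r₋ < r₀ ≤ ϱ ≤ r_b < r₊`; graph
zone: `ϱ′² ·` the landed certificate `Negative.conormalForm_bentSlope_neg`), `g(V, ·) > 0` on it fixes the
future sign, and `Kerr.bilin_pos_of_orthogonal` gives positivity of the induced form.
[cite: arXiv07060622, (32)–(36)] [cite: ONeill1983, Ch. 5 Lemma 5.26] -/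
theorem stub_capImmersion :
    ∀ [Kerr.Facts] (M a r₀ σ σ₄ c rb rc : ℝ) (hM : 0 ≤ M) (τ ϱ α : ℝ → ℝ) (X : E3 → E3),
      |a| < M → Kerr.rMinus M a < r₀ → rb < Kerr.rPlus M a → 0 ≤ rc → rc < r₀ → 0 < σ →
      ContDiff ℝ ∞ τ → ContDiff ℝ ∞ ϱ → ContDiff ℝ ∞ α →
      (∀ s, r₀ ≤ ϱ s) → (∀ s, 0 ≤ deriv τ s) → (∀ s, 0 ≤ deriv ϱ s) → (∀ s, 0 < deriv τ s + deriv ϱ s) →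
      (∀ s, s ≤ σ₄ → ϱ s ≤ rb) →
      (∀ s, σ₄ ≤ s → τ s = Negative.bentHeight M a (ϱ s) + c ∧ 0 < deriv ϱ s) →
      (∀ u : E3, X u =
        !₂[(ϱ ‖u‖ * (Real.cos (α ‖u‖) * u 0 - Real.sin (α ‖u‖) * u 1) -
              a * (Real.sin (α ‖u‖) * u 0 + Real.cos (α ‖u‖) * u 1)) / ‖u‖,
           (ϱ ‖u‖ * (Real.sin (α ‖u‖) * u 0 + Real.cos (α ‖u‖) * u 1) +
              a * (Real.cos (α ‖u‖) * u 0 - Real.sin (α ‖u‖) * u 1)) / ‖u‖,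
           ϱ ‖u‖ * u 2 / ‖u‖]) →
      (∀ (t : ℝ) (u : E3), u ≠ 0 → Kerr.radius a (E4.ofTimeSpace t (X u)) = ϱ ‖u‖) ∧
      ∀ (Ω : Opens E3) (Ψ : Ω → Kerr.region a rc), (Ω : Set E3) = {u : E3 | σ < ‖u‖} →
        (∀ u : Ω, (Ψ u : E4) = E4.ofTimeSpace (τ ‖(u : E3)‖) (X u)) →
        (Kerr.smoothMetric M a rc).IsSpacelikeImmersion 𝓘(ℝ, E3) Ψ ∧
        ∃ N : E3 → E4, ContDiffOn ℝ ∞ N Ω ∧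
          (Kerr.smoothMetric M a rc).IsFutureUnitNormal 𝓘(ℝ, E3)
            ((Kerr.timeOrientation M a rc hM).ofLE le_top) Ψ (fun u ↦ N u) :=
  @Summit.FinalStateConjecture.FinalStateConjecture.Theorems.SwallowTheDatum.stub_capImmersion


/-! ## Stub 3 — gluing the pocket to the induced data of the cap map -/

/-- **Stub `stub_capGlue`** (gluing on `E3`): the pocket datum `D'` (vacuum on `{‖y‖ < ρ₂}`, exact standard
Kerr cylinder on `{σ₂ < ‖y‖ < ρ₂}`) and the vacuum datum induced by the cap map `Ψ` on `Ω = {‖u‖ > σ₂'}`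
(`InducedVacuumData.lean` with `Kerr.ricci_smoothMetric`) agree on the collar `{σ₂' < ‖u‖ < ρ₂}` — there
`Ψ = kerrCylMap r₀ a τ₀ id` pointwise (`cos(−arctan(a/r₀)) = r₀/√(r₀²+a²)`, …), so the induced metrics agree and,
the future unit normal being unique, so do the second fundamental forms — and glue
(`Assembly.exists_initialDataSet_of_localData`) to one smooth vacuum datum `C` on `E3` which IS the induced
datum of `Ψ` on `Ω`. [cite: LiMei2020, Prop. 4.1] [cite: BartnikIsenberg2004, §2] -/
theorem stub_capGlue :
    ∀ [Kerr.Facts] (M a r₀ τ₀ σ₂ σ₂' ρ₂ rc : ℝ) (hM : 0 ≤ M) (D' : InitialDataSet (𝓡 3) E3)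
      (τ ϱ α : ℝ → ℝ) (X : E3 → E3) (Ω : Opens E3) (Ψ : Ω → Kerr.region a rc) (N : E3 → E4),
      |a| < M → Kerr.rMinus M a < r₀ → r₀ < Kerr.rPlus M a → 0 ≤ rc → rc < r₀ →
      1 ≤ σ₂ → σ₂ < σ₂' → σ₂' < ρ₂ →
      LiMei.IsVacuumOn {y : E3 | ‖y‖ < ρ₂} D' →
      LiMei.IsKerrCylinderOn M a r₀ τ₀ LinearIsometry.id {y : E3 | σ₂ < ‖y‖ ∧ ‖y‖ < ρ₂} D' →
      (∀ s, s ≤ ρ₂ → τ s = s + τ₀ ∧ ϱ s = r₀ ∧ α s = -Real.arctan (a / r₀)) →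
      (∀ u : E3, X u =
        !₂[(ϱ ‖u‖ * (Real.cos (α ‖u‖) * u 0 - Real.sin (α ‖u‖) * u 1) -
              a * (Real.sin (α ‖u‖) * u 0 + Real.cos (α ‖u‖) * u 1)) / ‖u‖,
           (ϱ ‖u‖ * (Real.sin (α ‖u‖) * u 0 + Real.cos (α ‖u‖) * u 1) +
              a * (Real.cos (α ‖u‖) * u 0 - Real.sin (α ‖u‖) * u 1)) / ‖u‖,
           ϱ ‖u‖ * u 2 / ‖u‖]) →
      (Ω : Set E3) = {u : E3 | σ₂' < ‖u‖} →
      (∀ u : Ω, (Ψ u : E4) = E4.ofTimeSpace (τ ‖(u : E3)‖) (X u)) →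
      (Kerr.smoothMetric M a rc).IsSpacelikeImmersion 𝓘(ℝ, E3) Ψ → ContDiffOn ℝ ∞ N Ω →
      (Kerr.smoothMetric M a rc).IsFutureUnitNormal 𝓘(ℝ, E3)
        ((Kerr.timeOrientation M a rc hM).ofLE le_top) Ψ (fun u ↦ N u) →
      ∃ C : InitialDataSet (𝓡 3) E3,
        (∀ [C.metric.HasLeviCivita], C.IsVacuumConstraintSolution) ∧
        (∀ (u : Ω) (v w : E3), C.h.inner (u : E3) v w =
          (Kerr.smoothMetric M a rc).inducedBilin 𝓘(ℝ, E3) Ψ u v w) ∧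
        (∀ [(Kerr.smoothMetric M a rc).HasLeviCivita] (u : Ω) (v w : E3), C.k (u : E3) v w =
          (Kerr.smoothMetric M a rc).secondFundamentalForm 𝓘(ℝ, E3) Ψ (fun u ↦ N u) u v w) :=
  @Summit.FinalStateConjecture.FinalStateConjecture.Theorems.SwallowTheDatum.stub_capGlue


/-! ## Stub 4 — the shielding block of the crux for the glued datum -/

/-- **Stub `stub_capShield`** (lead): a datum `C` on `E3` which on `Ω = {‖u‖ > σ}` IS the induced datum of the cap
map satisfies the crux's shielding block verbatim, with `(M, a)`, junction radius `r₁ = r_b ∈ (r₋, r₊)`, the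
literal height, `ψ = Negative.graph M a r_b` (the pinned graph), `ν = Negative.graphNormal M a r_b`, and the
end chart `φ(x⃗) = ϱ⁻¹(r) · Rot_z(−α(ϱ⁻¹ r)) ℓ⃗(x⃗)`, a diffeomorphism of `{r > r_b}` onto `{‖u‖ > σ₄}` inverse
to `X` (`L_r ℓ⃗(x⃗) = x⃗`); the pull-back identities are the chain rule for `pullbackBilin`, the
time-translation invariance of the Kerr–Schild data (`Ψ = (ψ + c e₀) ∘ X` on the graph zone) and the
reparametrisation naturality of `K_ν` (coordinate formula `OpensChart.secondFundamentalForm_eq_of_repr`).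
[cite: ONeill1983, Ch. 4, Lemma 4.4] [cite: arXiv08110354, §5.1] -/
theorem stub_capShield :
    ∀ [Kerr.Facts] (M a σ σ₄ c rb rc : ℝ) (hM : 0 ≤ M) (τ ϱ α ϱinv : ℝ → ℝ) (X : E3 → E3)
      (Ω : Opens E3) (Ψ : Ω → Kerr.region a rc) (N : E3 → E4) (C : InitialDataSet (𝓡 3) E3),
      |a| < M → Kerr.rMinus M a < rb → rb < Kerr.rPlus M a → 0 ≤ rc → rc ≤ rb → 0 < σ → σ < σ₄ →
      ContDiff ℝ ∞ τ → ContDiff ℝ ∞ ϱ → ContDiff ℝ ∞ α →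
      (∀ s, σ₄ ≤ s → τ s = Negative.bentHeight M a (ϱ s) + c ∧ 0 < deriv ϱ s) →
      (∀ s, σ₄ < s → rb < ϱ s ∧ ϱinv (ϱ s) = s) →
      (∀ r, rb < r → σ₄ < ϱinv r ∧ ϱ (ϱinv r) = r) →
      ContDiffOn ℝ ∞ ϱinv (Set.Ioi rb) →
      (∀ u : E3, X u =
        !₂[(ϱ ‖u‖ * (Real.cos (α ‖u‖) * u 0 - Real.sin (α ‖u‖) * u 1) -
              a * (Real.sin (α ‖u‖) * u 0 + Real.cos (α ‖u‖) * u 1)) / ‖u‖,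
           (ϱ ‖u‖ * (Real.sin (α ‖u‖) * u 0 + Real.cos (α ‖u‖) * u 1) +
              a * (Real.cos (α ‖u‖) * u 0 - Real.sin (α ‖u‖) * u 1)) / ‖u‖,
           ϱ ‖u‖ * u 2 / ‖u‖]) →
      (Ω : Set E3) = {u : E3 | σ < ‖u‖} →
      (∀ u : Ω, (Ψ u : E4) = E4.ofTimeSpace (τ ‖(u : E3)‖) (X u)) →
      (Kerr.smoothMetric M a rc).IsSpacelikeImmersion 𝓘(ℝ, E3) Ψ → ContDiffOn ℝ ∞ N Ω →
      (Kerr.smoothMetric M a rc).IsFutureUnitNormal 𝓘(ℝ, E3)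
        ((Kerr.timeOrientation M a rc hM).ofLE le_top) Ψ (fun u ↦ N u) →
      (∀ (u : Ω) (v w : E3), C.h.inner (u : E3) v w =
          (Kerr.smoothMetric M a rc).inducedBilin 𝓘(ℝ, E3) Ψ u v w) →
      (∀ [(Kerr.smoothMetric M a rc).HasLeviCivita] (u : Ω) (v w : E3), C.k (u : E3) v w =
          (Kerr.smoothMetric M a rc).secondFundamentalForm 𝓘(ℝ, E3) Ψ (fun u ↦ N u) u v w) →
      ∃ (a' r₁ : ℝ) (hM' : 0 ≤ M) (T : ℝ → ℝ) (φ : Literature.Geometry.Lorentzian.Kerr.slice a' r₁ → Literature.Geometry.Lorentzian.E3) (ψ : Literature.Geometry.Lorentzian.Kerr.slice a' r₁ → Literature.Geometry.Lorentzian.Kerr.region a' r₁) (ν : Literature.Geometry.Lorentzian.NormalField 𝓘(ℝ, Literature.Geometry.Lorentzian.E4) ψ), |a'| < M ∧ Literature.Geometry.Lorentzian.Kerr.rMinus M a' < r₁ ∧ r₁ < Literature.Geometry.Lorentzian.Kerr.rPlus M a' ∧ T = (fun r : ℝ => Real.smoothTransition (r / (4 * M) - 1) * (((M) / Real.sqrt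 ((M) ^ 2 - (a') ^ 2)) * (Literature.Geometry.Lorentzian.Kerr.rPlus M a' * Real.log (r - Literature.Geometry.Lorentzian.Kerr.rPlus M a') - Literature.Geometry.Lorentzian.Kerr.rMinus M a' * Real.log (r - Literature.Geometry.Lorentzian.Kerr.rMinus M a')) - ((M) / Real.sqrt ((M) ^ 2 - (a') ^ 2)) * (Literature.Geometry.Lorentzian.Kerr.rPlus M a' * Real.log ((4 * M) - Literature.Geometry.Lorentzian.Kerr.rPlus M a') - Literature.Geometry.Lorentzian.Kerr.rMinus M a' * Real.log ((4 * M) - Literature.Geometry.Lorentzian.Kerr.rMinus M a')))) ∧ IsCompact (Set.range φ)ᶜ ∧ Topology.IsOpenEmbedding φ ∧ ContMDiff 𝓘(ℝ, Literature.Geometry.Lorentzian.E3) (𝓡 3) ((⊤ : ℕ∞) : WithTop ℕ∞) φ ∧ (∀ y : Literature.Geometry.Lorentzian.Kerr.slice a' r₁, (ψ y : Literature.Geometry.Lorentzian.E4) = Literature.Geometry.Lorentzian.E4.ofTimeSpace (T (Literature.Geometry.Lorentzian.Kerr.radius a' (Literature.Geometry.Lorentzian.E4.ofTimeSpace 0 (y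 : Literature.Geometry.Lorentzian.E3)))) (y : Literature.Geometry.Lorentzian.E3)) ∧ (Literature.Geometry.Lorentzian.Kerr.smoothMetric M a' r₁).IsSpacelikeImmersion 𝓘(ℝ, Literature.Geometry.Lorentzian.E3) ψ ∧ (Literature.Geometry.Lorentzian.Kerr.smoothMetric M a' r₁).IsFutureUnitNormal 𝓘(ℝ, Literature.Geometry.Lorentzian.E3) ((Literature.Geometry.Lorentzian.Kerr.timeOrientation M a' r₁ hM').ofLE le_top) ψ ν ∧ (∀ y : Literature.Geometry.Lorentzian.Kerr.slice a' r₁, Literature.Geometry.Lorentzian.pullbackBilin (I := 𝓡 3) (I' := 𝓘(ℝ, Literature.Geometry.Lorentzian.E3)) φ (C).h.inner y = Literature.Geometry.Lorentzian.pullbackBilin (I := 𝓘(ℝ, Literature.Geometry.Lorentzian.E4)) (I' := 𝓘(ℝ, Literature.Geometry.Lorentzian.E3)) ψ (Literature.Geometry.Lorentzian.Kerr.smoothMetric M a' r₁).val y) ∧ (∀ [(Literature.Geometry.Lorentzian.Kerr.smoothMetric M a' r₁).HasLeviCivita] (y : Literature.Geometry.Lorentzian.Kerr.slice a' r₁), (Literature.Geometry.Lorentzian.pullbackBilin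 (I := 𝓡 3) (I' := 𝓘(ℝ, Literature.Geometry.Lorentzian.E3)) φ (C).k y).toLinearMap₁₂ = (Literature.Geometry.Lorentzian.Kerr.smoothMetric M a' r₁).secondFundamentalForm 𝓘(ℝ, Literature.Geometry.Lorentzian.E3) ψ ν y) :=
  @Summit.FinalStateConjecture.FinalStateConjecture.Theorems.SwallowTheDatum.stub_capShield


/-! ## Stubs 5–6 — the far zone is a Dafermos–Rodnianski end with template mass `M` -/

/-- **Stub `stub_capFarH`** (asymptotics of the metric): on the far zone `s ≥ σ₅` the induced metric of the cap map
is the Boyer–Lindquist slice metric of Kerr(`M, a`) in quasi-isotropic Cartesian coordinates,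
`h_u(v, w) = (Σ/s²)⟨v, w⟩ + (a²(r² + 2Mr + a²μ²)/(Σ s⁴)) (u₀v₁ − u₁v₀)(u₀w₁ − u₁w₀)` with `r = ϱ(s)`,
`μ = u₂/s`, `Σ = r² + a²μ²` (the ingoing-coordinate form `Kerr.Ingoing.kerrBilin_jac` with `dt* = T′dr`,
`T′ = 2Mr/Δ` beyond `8M`, `dφ = dφ_BL + (a/Δ)dr`, and `Σ/Δ · ϱ′² = Σ/s²`), so that any total field `hTot`
agreeing with it there satisfies `hTot − (1 + 2M/s) δ ∈ O₂(s⁻²)` (`Σ/s² − 1 − 2M/s = (M² + 2c₀ + a²μ²)/s² + …`,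
`c₀ = (M² − a²)/4`; symbol calculus `DecaySymbols*.lean`). [cite: BrandtSeidel1996] [cite: Bartnik1986, Def. 2.1] -/
theorem stub_capFarH :
    ∀ [Kerr.Facts] (M a c σ σ₅ rc : ℝ) (τ ϱ α : ℝ → ℝ) (X : E3 → E3) (Ω : Opens E3)
      (Ψ : Ω → Kerr.region a rc) (hTot : E3 → E3 →L[ℝ] E3 →L[ℝ] ℝ),
      |a| < M → 0 ≤ rc → 0 < σ → σ < σ₅ →
      ContDiff ℝ ∞ τ → ContDiff ℝ ∞ ϱ → ContDiff ℝ ∞ α →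
      (∀ s, σ₅ ≤ s → τ s = Negative.bentHeight M a (ϱ s) + c ∧
        ϱ s = s + M + (M ^ 2 - a ^ 2) / (4 * s) ∧
        α s = a / (Kerr.rPlus M a - Kerr.rMinus M a) *
          Real.log ((ϱ s - Kerr.rPlus M a) / (ϱ s - Kerr.rMinus M a))) →
      (∀ s, σ₅ ≤ s → 8 * M < ϱ s) →
      (∀ u : E3, X u =
        !₂[(ϱ ‖u‖ * (Real.cos (α ‖u‖) * u 0 - Real.sin (α ‖u‖) * u 1) -
              a * (Real.sin (α ‖u‖) * u 0 + Real.cos (α ‖u‖) * u 1)) / ‖u‖,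
           (ϱ ‖u‖ * (Real.sin (α ‖u‖) * u 0 + Real.cos (α ‖u‖) * u 1) +
              a * (Real.cos (α ‖u‖) * u 0 - Real.sin (α ‖u‖) * u 1)) / ‖u‖,
           ϱ ‖u‖ * u 2 / ‖u‖]) →
      (Ω : Set E3) = {u : E3 | σ < ‖u‖} →
      (∀ u : Ω, (Ψ u : E4) = E4.ofTimeSpace (τ ‖(u : E3)‖) (X u)) →
      (∀ (u : Ω), σ₅ < ‖(u : E3)‖ → ∀ v w : E3,
        hTot (u : E3) v w = (Kerr.smoothMetric M a rc).inducedBilin 𝓘(ℝ, E3) Ψ u v w) →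
      IsBigOSmooth 2 (-2) fun y : E3 ↦ hTot y - (1 + 2 * M / ‖y‖) • (innerSL ℝ : E3 →L[ℝ] E3 →L[ℝ] ℝ) :=
  @Summit.FinalStateConjecture.FinalStateConjecture.Theorems.SwallowTheDatum.stub_capFarH


/-- **Stub `stub_capFarK`** (asymptotics of the second fundamental form): on the far zone the cap map is the
Boyer–Lindquist slice `{t_BL = const}` of Kerr(`M, a`), whose second fundamental form w.r.t. the future unit
normal (unique, whatever representative `N` is given) is `O(aM s⁻³)` with one derivative `O(s⁻⁴)` in the
quasi-isotropic Cartesian coordinates (only the `rφ` and `μφ` Boyer–Lindquist components are nonzero, of orders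
`aM/r²` and `a³M/r³`): any total field `kTot` agreeing with it there lies in `O₁(s⁻³)`.
[cite: BrandtSeidel1996] [cite: Cook2000, §3.2] [cite: Bartnik1986, Def. 2.1] -/
theorem stub_capFarK :
    ∀ [Kerr.Facts] (M a c σ σ₅ rc : ℝ) (hM : 0 ≤ M) (τ ϱ α : ℝ → ℝ) (X : E3 → E3) (Ω : Opens E3)
      (Ψ : Ω → Kerr.region a rc) (N : E3 → E4) (kTot : E3 → E3 →L[ℝ] E3 →L[ℝ] ℝ),
      |a| < M → 0 ≤ rc → 0 < σ → σ < σ₅ →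
      ContDiff ℝ ∞ τ → ContDiff ℝ ∞ ϱ → ContDiff ℝ ∞ α →
      (∀ s, σ₅ ≤ s → τ s = Negative.bentHeight M a (ϱ s) + c ∧
        ϱ s = s + M + (M ^ 2 - a ^ 2) / (4 * s) ∧
        α s = a / (Kerr.rPlus M a - Kerr.rMinus M a) *
          Real.log ((ϱ s - Kerr.rPlus M a) / (ϱ s - Kerr.rMinus M a))) →
      (∀ s, σ₅ ≤ s → 8 * M < ϱ s) →
      (∀ u : E3, X u =
        !₂[(ϱ ‖u‖ * (Real.cos (α ‖u‖) * u 0 - Real.sin (α ‖u‖) * u 1) -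
              a * (Real.sin (α ‖u‖) * u 0 + Real.cos (α ‖u‖) * u 1)) / ‖u‖,
           (ϱ ‖u‖ * (Real.sin (α ‖u‖) * u 0 + Real.cos (α ‖u‖) * u 1) +
              a * (Real.cos (α ‖u‖) * u 0 - Real.sin (α ‖u‖) * u 1)) / ‖u‖,
           ϱ ‖u‖ * u 2 / ‖u‖]) →
      (Ω : Set E3) = {u : E3 | σ < ‖u‖} →
      (∀ u : Ω, (Ψ u : E4) = E4.ofTimeSpace (τ ‖(u : E3)‖) (X u)) →
      (Kerr.smoothMetric M a rc).IsFutureUnitNormal 𝓘(ℝ, E3)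
        ((Kerr.timeOrientation M a rc hM).ofLE le_top) Ψ (fun u ↦ N u) → ContDiffOn ℝ ∞ N Ω →
      (∀ [(Kerr.smoothMetric M a rc).HasLeviCivita] (u : Ω), σ₅ < ‖(u : E3)‖ → ∀ v w : E3,
        kTot (u : E3) v w = (Kerr.smoothMetric M a rc).secondFundamentalForm 𝓘(ℝ, E3) Ψ (fun u ↦ N u) u v w) →
      IsBigOSmooth 1 (-3) kTot :=
  @Summit.FinalStateConjecture.FinalStateConjecture.Theorems.SwallowTheDatum.stub_capFarK


/-! ## Composition -/

/-- Dafermos–Rodnianski strong asymptotic flatness on an end from symbol estimates `O₂(r⁻²)` of the metric defect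
and `O₁(r⁻³)` of `k` (both one order better than required: `O(r^{−2−m}) = o(r^{−1−m})`,
`O(r^{−3−m}) = o(r^{−2−m})`). Dafermos–Rodnianski arXiv:0811.0354, App. B.2.3. [cite: DafermosRodnianski2013, App. B.2.3] -/
theorem isStronglyAsymptoticallyFlatDR_of_isBigOSmooth (e : AFEnd E3) (D : InitialDataSet (𝓡 3) E3) (M : ℝ)
    (hh : IsBigOSmooth 2 (-2) fun y : E3 ↦
      AFEnd.hCoeff e D y - (1 + 2 * M / ‖y‖) • (innerSL ℝ : E3 →L[ℝ] E3 →L[ℝ] ℝ))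
    (hk : IsBigOSmooth 1 (-3) (AFEnd.kCoeff e D)) :
    e.IsStronglyAsymptoticallyFlatDR D M := by
  refine ⟨fun m hm ↦ ?_, fun m hm ↦ ?_⟩
  · have h1 := hh.isBigO hm
    refine h1.trans_isLittleO ?_
    have h2 := isLittleO_norm_rpow_rpow_cobounded_of_lt (E := E3) (p := -2 - (m : ℝ)) (q := -1 - (m : ℝ))
      (by linarith)
    exact h2
  · have h1 := hk.isBigO hm
    refine h1.trans_isLittleO ?_
    exact isLittleO_norm_rpow_rpow_cobounded_of_lt (E := E3) (by linarith)

/-- **Composition (kernel-checked; no `sorry` of its own — it applies the seven registered stubs by name and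
concludes the crux decl by name).** Exact pocket → profiles → cap map (membership by the radius identity) →
immersion + normal → glue → shield block; far stubs → Dafermos–Rodnianski end (tautological chart) → sole end,
completeness (`isComplete_of_isSoleEnd_holds`) → `admissibleVacuumData` → `KerrShieldedDataExist`.
[cite: LiMei2020, §2.2] [cite: Christodoulou1999, p. A24] -/
theorem KerrShieldedDataExist_of :
    Summit.FinalStateConjecture.FinalStateConjecture.Theses.SwallowTheDatum.KerrShieldedDataExist := by
  have h0 := @stub_exactPocket
  have h1 := stub_capProfile
  have h2 := @stub_capImmersion
  have h3 := @stub_capGlue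
  have h4 := @stub_capShield
  have h5 := @stub_capFarH
  have h6 := @stub_capFarK
  intro inst
  obtain ⟨M, a, r₀, τ₀, σ₂, ρ₂, D', ha, hr₀m, hr₀p, hσ₂, hσρ, hvac', hcyl⟩ := @h0 inst
  have hM0 : 0 < M := (abs_nonneg a).trans_lt ha
  have hM : 0 ≤ M := hM0.le
  have hrm0 : 0 ≤ Kerr.rMinus M a := Kerr.IsSubextremal.rMinus_nonneg ha
  have hr₀ : 0 < r₀ := hrm0.trans_lt hr₀m
  -- the profiles, with cylinder zone up to `σ₃ := ρ₂`
  obtain ⟨τ, ϱ, α, ϱinv, σ₄, σ₅, c, rb, h34, h45, hrb0, hrbp, hτs, hϱs, hαs, hcylz, hϱge, hτ', hϱ', hsum,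
    hle, hgraph, hinv1, hinv2, hinvs, hfar, h8⟩ :=
    h1 M a r₀ τ₀ ρ₂ ha hr₀m hr₀p (hσ₂.trans hσρ.le)
  -- chart radius `rc := r₀/2`, immersion domain `{‖u‖ > σ}`, `σ := (σ₂ + ρ₂)/2`
  set rc : ℝ := r₀ / 2 with hrc
  have hrc0 : 0 ≤ rc := by rw [hrc]; positivity
  have hrcr : rc < r₀ := by rw [hrc]; linarith
  set σ : ℝ := (σ₂ + ρ₂) / 2 with hσdef
  have hσ2 : σ₂ < σ := by rw [hσdef]; linarith
  have hσρ' : σ < ρ₂ := by rw [hσdef]; linarith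
  have hσ0 : 0 < σ := by linarith
  have hσ4 : σ < σ₄ := by linarith
  -- the cap map
  set X : E3 → E3 := fun u ↦
    !₂[(ϱ ‖u‖ * (Real.cos (α ‖u‖) * u 0 - Real.sin (α ‖u‖) * u 1) -
          a * (Real.sin (α ‖u‖) * u 0 + Real.cos (α ‖u‖) * u 1)) / ‖u‖,
       (ϱ ‖u‖ * (Real.sin (α ‖u‖) * u 0 + Real.cos (α ‖u‖) * u 1) +
          a * (Real.cos (α ‖u‖) * u 0 - Real.sin (α ‖u‖) * u 1)) / ‖u‖,
       ϱ ‖u‖ * u 2 / ‖u‖] with hXdef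
  have hX : ∀ u : E3, X u =
      !₂[(ϱ ‖u‖ * (Real.cos (α ‖u‖) * u 0 - Real.sin (α ‖u‖) * u 1) -
            a * (Real.sin (α ‖u‖) * u 0 + Real.cos (α ‖u‖) * u 1)) / ‖u‖,
         (ϱ ‖u‖ * (Real.sin (α ‖u‖) * u 0 + Real.cos (α ‖u‖) * u 1) +
            a * (Real.cos (α ‖u‖) * u 0 - Real.sin (α ‖u‖) * u 1)) / ‖u‖,
         ϱ ‖u‖ * u 2 / ‖u‖] := fun u ↦ rfl
  obtain ⟨hrad, himm⟩ := h2 M a r₀ σ σ₄ c rb rc hM τ ϱ α X ha hr₀m hrbp hrc0 hrcr hσ0 hτs hϱs hαs hϱge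
    hτ' hϱ' hsum hle hgraph hX
  let Ω : Opens E3 := ⟨{u : E3 | σ < ‖u‖}, isOpen_lt continuous_const continuous_norm⟩
  have hΩ : (Ω : Set E3) = {u : E3 | σ < ‖u‖} := rfl
  have hmem : ∀ u : Ω, E4.ofTimeSpace (τ ‖(u : E3)‖) (X u) ∈ Kerr.region a rc := by
    intro u
    have hu : σ < ‖(u : E3)‖ := u.2
    have hu0 : (u : E3) ≠ 0 := by
      intro h0
      rw [h0, norm_zero] at hu
      linarith
    rw [Kerr.mem_region, hrad _ _ hu0]
    exact max_lt (by linarith [hϱge ‖(u : E3)‖]) (by linarith [hϱge ‖(u : E3)‖])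
  let Ψ : Ω → Kerr.region a rc := fun u ↦ ⟨E4.ofTimeSpace (τ ‖(u : E3)‖) (X u), hmem u⟩
  have hΨ : ∀ u : Ω, (Ψ u : E4) = E4.ofTimeSpace (τ ‖(u : E3)‖) (X u) := fun u ↦ rfl
  obtain ⟨hsp, N, hNs, hN⟩ := himm Ω Ψ hΩ hΨ
  -- glue the pocket to the induced data of the cap map
  obtain ⟨C, hCvac, hCh, hCk⟩ := h3 M a r₀ τ₀ σ₂ σ ρ₂ rc hM D' τ ϱ α X Ω Ψ N ha hr₀m hr₀p hrc0 hrcr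
    hσ₂ hσ2 hσρ' hvac' hcyl (fun s hs ↦ hcylz s hs) hX hΩ hΨ hsp hNs hN
  -- the shielding block
  obtain hblock := h4 M a σ σ₄ c rb rc hM τ ϱ α ϱinv X Ω Ψ N C ha (hr₀m.trans hrb0) hrbp hrc0
    (by linarith) hσ0 hσ4 hτs hϱs hαs hgraph hinv1 hinv2 hinvs hX hΩ hΨ hsp hNs hN hCh hCk
  -- the far end: tautological chart beyond `σ₅`
  have hσ₅ : 0 < σ₅ := by linarith
  let e : AFEnd E3 := ⟨exteriorRegion σ₅, σ₅, hσ₅, Diffeomorph.refl (𝓡 3) (exteriorRegion σ₅) ∞,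
    fun R' hR' ↦ isClosed_image_val_preimage_refl hR'⟩
  have hsole : e.IsSoleEnd := isSoleEnd_of_chart_id e (fun _ ↦ rfl) (fun _ h ↦ h)
  have hfarz : ∀ s, σ₅ ≤ s → τ s = Negative.bentHeight M a (ϱ s) + c ∧
      ϱ s = s + M + (M ^ 2 - a ^ 2) / (4 * s) ∧
      α s = a / (Kerr.rPlus M a - Kerr.rMinus M a) *
        Real.log ((ϱ s - Kerr.rPlus M a) / (ϱ s - Kerr.rMinus M a)) := fun s hs ↦
    ⟨(hgraph s (by linarith)).1, (hfar s hs).1, (hfar s hs).2⟩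
  have hσσ₅ : σ < σ₅ := by linarith
  have hmemΩ : ∀ u : Ω, σ₅ < ‖(u : E3)‖ → e.R < ‖(u : E3)‖ := fun u hu ↦ hu
  have hH := h5 M a c σ σ₅ rc τ ϱ α X Ω Ψ (AFEnd.hCoeff e C) ha hrc0 hσ0 hσσ₅ hτs hϱs hαs hfarz h8 hX
    hΩ hΨ (fun u hu v w ↦ by
      rw [hCoeff_apply_of_dataChart_eq e (fun _ ↦ rfl) C (hmemΩ u hu) v w, hCh u v w])
  have hK := h6 M a c σ σ₅ rc hM τ ϱ α X Ω Ψ N (AFEnd.kCoeff e C) ha hrc0 hσ0 hσσ₅ hτs hϱs hαs hfarz h8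
    hX hΩ hΨ hN hNs (fun u hu v w ↦ by
      rw [kCoeff_apply_of_dataChart_eq e (fun _ ↦ rfl) C (hmemΩ u hu) v w, hCk u v w])
  have hDR : e.IsStronglyAsymptoticallyFlatDR C M := isStronglyAsymptoticallyFlatDR_of_isBigOSmooth e C M hH hK
  have hadm : C ∈ admissibleVacuumData E3 := by
    refine mem_admissibleVacuumData_iff.mpr ⟨?_, e, M, hsole, hDR⟩
    intro hLC
    exact ⟨hCvac, isComplete_of_isSoleEnd_holds E3 C e M 1 2 2 1 zero_le_one hDR hsole⟩
  exact ⟨C, hadm, M, hblock⟩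

end Summit.FinalStateConjecture.FinalStateConjecture.Cruxes.KerrShieldedDataExist.PlugTheSecondSheet

end
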